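import Literature.Computability.AlgebraicComplexity.ValiantBooleanBridgeProofs
import Literature.Computability.Complexity.AaronsonVanMelkebeek2011
import Literature.Computability.Complexity.PolyExistsNTIME
import Literature.Computability.Complexity.StructuralPHProofs
import Literature.Computability.Complexity.CountingHierarchyPH
import Literature.Computability.Complexity.CountingProofs
import Literature.Computability.Complexity.PRelHierarchy
import Literature.Computability.Complexity.AaronsonVanMelkebeek2011Proofs
import Literature.Computability.Complexity.NSubexpKarpProofs
import Literature.Computability.AlgebraicComplexity.PermanentGraphNSUBEXP
import HarnessLib

/-!
# Kabanets–Impagliazzo (pnp.S39) along Aaronson–van Melkebeek: a shorter trust base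

Second companion file of `Literature.Computability.AlgebraicComplexity.ValiantBooleanBridge` for
the named fact **pnp.S39** `kabanets_impagliazzo` (Kabanets–Impagliazzo, STOC 2003, Def. 1 +
Thm. 18; Comput. Complexity 13 (2004), Thm. 1.1). The first companion
(`ValiantBooleanBridgeProofs.lean`) assembles the fact along the printed proof / Arora–Barak's
Thm. 20.17 from EIGHT named facts, among them the Impagliazzo–Kabanets–Wigderson collapse
`NEXP ⊆ P/poly ⟹ NEXP = EXP`, Meyer's theorem, Toda's theorem and the nondeterministic time
hierarchy theorem — each a large formalisation of its own. Aaronson and van Melkebeek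
(*On circuit lower bounds from derandomization*, Theory of Computing 7 (2011) 177–184, §3.3 "The
new argument") prove the same theorem avoiding all four: with Kannan's theorem (PROVED in the
tree: `kannan_holds`, `StructuralPHProofs.lean`) the argument is

1. (their Lemma 3.1, §3.1) `PIT ∈ NSUBEXP` and polynomial-size (here: p-bounded constant-free)
   arithmetic circuits for `(PER_n)` give `Σ₂ᵖ ⊆ NSUBEXP`: `coNP ⊆ P^{#P} ⊆ P^{per}` (Valiant)
   `⊆ NSUBEXP` (Kabanets–Impagliazzo's guess-and-verify, Cor. 12 + Lemma 3), and one polynomially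
   bounded `∃` in front of an `NSUBEXP` predicate stays in `NSUBEXP`;
2. (§3.3, display (3), printed `Σ₂ᵖ ⊆ NTIME(2^{O(n)}) ⊆ SIZE(n^c)` "for some constant `c`";
   in the tree's classes `Σ₂ᵖ ⊆ NSUBEXP ⊆ NTIME(2ⁿ) ⊆ NE ⊆ ⋃_c SIZE(c·n^k + c)` for ONE exponent
   `k`), the last inclusion from `NEXP ⊆ P/poly` through a complete problem for `NTIME(2^{O(n)})`;
3. contradiction with Kannan's theorem `∀ k, ∃ L ∈ Σ₂ᵖ ∩ Π₂ᵖ, L ∉ ⋃_c SIZE(c·n^k + c)`.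

Accordingly `kabanets_impagliazzo_of_facts_avm` derives `kabanets_impagliazzo` from FIVE named
facts, three of them shared with the first companion:

| step | tree fact | file |
|---|---|---|
| Valiant, `Perm` is `#P`-hard | `permanent01_isSharpPHardFun` | `QuantumComplexity/PermanentHardness` |
| KI Cor. 12 (`Perm`-graph `∈ NSUBEXP`) | `permanent01Graph_mem_NSUBEXP_of_PIT` | `ValiantBooleanBridgeProofs` |
| KI Lemma 3 (`P^{Perm} ⊆ NSUBEXP`) | `PRel_per01_subset_NSUBEXP_of_graph` | `ValiantBooleanBridgeProofs` |
| AvM (3): `NEXP ⊆ P/poly ⟹ ∃ k, NE ⊆ ⋃_c SIZE(c·n^k + c)` | `NE_subset_SIZE_of_NEXP_subset_PPoly` | `Complexity/AaronsonVanMelkebeek2011` |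
| `∃`-closure of `NSUBEXP` | `polyExists_NSUBEXP_subset_NSUBEXP` | `Complexity/AaronsonVanMelkebeek2011` |

Everything else is proved in the tree and used here: Kannan's theorem (`kannan_holds`),
`NP ⊆ PP` (`NP_subset_PP_holds`), `PP ⊆ P^{#P}` (`PP_subset_PSharpP_holds`), `P^{#P} ⊆ P^{per}`
for a `#P`-hard permanent (`PSharpP_subset_PRel_per01Fn`), closure of `P^O` under complement
(`compl_mem_PRel`), `Π₁ᵖ = coNP` (`PiP_one_holds`), `NSUBEXP ⊆ NTIME(2ⁿ)`
(`NSUBEXP_subset_NTIME_two_pow`), and Cor. 12 + Lemma 3 combined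
(`PRel_per01_subset_NSUBEXP_of_PIT`). When the five facts are discharged,
`kabanets_impagliazzo_holds` is `kabanets_impagliazzo_of_facts_avm` applied to their `_holds`
theorems; the `∃`-closure of `NSUBEXP` IS discharged (`polyExists_NSUBEXP_subset_NSUBEXP_holds`,
`Complexity/PolyExistsNTIME.lean`), whence `kabanets_impagliazzo_of_facts_avm'` from the
remaining FOUR facts.

The Aaronson–van Melkebeek fact is discharged as well (`NE_subset_SIZE_of_NEXP_subset_PPoly_holds`,
`Complexity/AaronsonVanMelkebeek2011Proofs.lean`, through clocked universal acceptance testing),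
whence `kabanets_impagliazzo_of_facts₃` from exactly the THREE results the printed proof of
Kabanets–Impagliazzo's Thm. 18 imports or proves about the permanent — Valiant's Thm. 1, Cor. 12,
Lemma 3 — and nothing else; and, with the Karp-closure of `NSUBEXP`
(`NSUBEXP_of_karpReducible_holds`, `Complexity/NSubexpKarpProofs.lean`) and the decomposition of
Cor. 12 of `PermanentGraphNSUBEXP.lean`, `kabanets_impagliazzo_of_facts₃'` with Cor. 12 replaced by
its reduction core `permanent01Graph_polyExists_preimage_PIT` (Lemma 11 as one `FP` many-one
reduction of the permanent graph to `∃ · PIT`).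

## References

* S. Aaronson, D. van Melkebeek, *On circuit lower bounds from derandomization*, Theory of
  Computing 7 (2011) 177–184: §3.1 (Lemma 3.1, Claim 3.2), §3.3 (display (3)), §1.
* V. Kabanets, R. Impagliazzo, *Derandomizing polynomial identity tests means proving circuit
  lower bounds*, STOC 2003, 355–364: Thm. 1, Lemma 3, Cor. 12, Def. 1, Thm. 18 (pp. 357–359);
  Comput. Complexity 13 (2004) 1–46, Thm. 1.1.
* R. Kannan, *Circuit-size lower bounds and non-reducibility to sparse sets*, Inform. Control 55
  (1982), Thm. 2.
-/

noncomputable section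

namespace Literature.Computability.AlgebraicComplexity

open _root_.Computability Complexity QuantumComplexity Nondeterministic

/-! ### Step 1: `Σ₂ᵖ ⊆ NSUBEXP` (Aaronson–van Melkebeek, Lemma 3.1) -/

/-- **`coNP ⊆ P^{per}`** for the `0/1` permanent, from Valiant's theorem: `L ∈ coNP` means
`Lᶜ ∈ NP ⊆ PP ⊆ P^{#P} ⊆ P^{per}` (`NP_subset_PP_holds`, `PP_subset_PSharpP_holds`,
`PSharpP_subset_PRel_per01Fn`), and `P^{per}` is closed under complement (`compl_mem_PRel`).
This is "for any language `L ∈ coNP` there exists a function `f ∈ #P` such that `x ∈ L` iff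
`f(x) = 0` … it suffices to [decide] whether the permanent of a given matrix … is zero" of
Aaronson–van Melkebeek 2011, proof of Lemma 3.1, at the level of the tree's classes.
[cite: AaronsonMelkebeek2011, §3.1 (proof of Lemma 3.1)] -/
theorem coNP_subset_PRel_per01 (hV : permanent01_isSharpPHardFun) :
    coNP ⊆ PRel (Oracle.ofFun per01Fn) := by
  intro L hL
  have h : Lᶜ ∈ PRel (Oracle.ofFun per01Fn) :=
    PSharpP_subset_PRel_per01Fn hV (PP_subset_PSharpP_holds (NP_subset_PP_holds hL))
  simpa only [compl_compl] using compl_mem_PRel h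

/-- **`coNP ⊆ NSUBEXP`** under `PIT ∈ NSUBEXP` and p-bounded constant-free circuits for
`(PER_n)`: `coNP ⊆ P^{per}` (Valiant) and `P^{per} ⊆ NSUBEXP` (Kabanets–Impagliazzo, Cor. 12
with Lemma 3: `PRel_per01_subset_NSUBEXP_of_PIT`). Aaronson–van Melkebeek 2011, proof of
Lemma 3.1: "we will show that `coNP ⊆ NSUBEXP`". [cite: AaronsonMelkebeek2011, §3.1 (proof of Lemma 3.1)] -/
theorem coNP_subset_NSUBEXP_of_PIT (hV : permanent01_isSharpPHardFun)
    (h12 : permanent01Graph_mem_NSUBEXP_of_PIT) (h3 : PRel_per01_subset_NSUBEXP_of_graph)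
    (hPIT : PITLanguage ∈ NSUBEXP)
    (hper : IsPBounded (fun n => constantFreeComplexity (perPoly (Fin n) ℤ))) :
    coNP ⊆ NSUBEXP :=
  (coNP_subset_PRel_per01 hV).trans (PRel_per01_subset_NSUBEXP_of_PIT h12 h3 hPIT hper)

/-- **Aaronson–van Melkebeek 2011, Lemma 3.1** (from the facts): "If `PIT ∈ NSUBEXP` and
`PERM ∈ ASIZE(poly(n))` then `Σ₂ᵖ ⊆ NSUBEXP`" — here with the permanent hypothesis in the
tree's constant-free form of pnp.S39. Proof as printed: `Σ₂ᵖ = ∃ᵖ·Π₁ᵖ = ∃ᵖ·coNP`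
(`SigmaP_succ`, `PiP_one_holds`), `coNP ⊆ NSUBEXP` (`coNP_subset_NSUBEXP_of_PIT`), and the
polynomially bounded `∃` keeps us in `NSUBEXP` (`polyExists_NSUBEXP_subset_NSUBEXP`).
[cite: AaronsonMelkebeek2011, Lemma 3.1] -/
theorem SigmaP_two_subset_NSUBEXP_of_PIT (hV : permanent01_isSharpPHardFun)
    (h12 : permanent01Graph_mem_NSUBEXP_of_PIT) (h3 : PRel_per01_subset_NSUBEXP_of_graph)
    (hE : polyExists_NSUBEXP_subset_NSUBEXP) (hPIT : PITLanguage ∈ NSUBEXP)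
    (hper : IsPBounded (fun n => constantFreeComplexity (perPoly (Fin n) ℤ))) :
    SigmaP 2 ⊆ NSUBEXP := by
  rw [SigmaP_succ, PiP_one_holds]
  exact (polyExists_mono (coNP_subset_NSUBEXP_of_PIT hV h12 h3 hPIT hper)).trans hE

/-! ### Step 2: the chain (3) and the contradiction with Kannan's theorem -/

/-- **Display (3) of Aaronson–van Melkebeek 2011, §3.3, in the tree's classes**: under the three
hypotheses (`PIT ∈ NSUBEXP`, `NEXP ⊆ P/poly`, p-bounded constant-free circuits for `(PER_n)`) and
the facts, there is ONE exponent `k` with `Σ₂ᵖ ⊆ ⋃_c SIZE(c·n^k + c)`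
(`Σ₂ᵖ ⊆ NSUBEXP ⊆ NTIME(2ⁿ) ⊆ NE ⊆ ⋃_c SIZE(c·n^k + c)`; printed: `Σ₂ᵖ ⊆ NTIME(2^{O(n)}) ⊆ SIZE(n^c)`
"for some constant `c`"). [cite: AaronsonMelkebeek2011, §3.3 (display (3))] -/
theorem SigmaP_two_subset_SIZE_of_facts (hV : permanent01_isSharpPHardFun)
    (h12 : permanent01Graph_mem_NSUBEXP_of_PIT) (h3 : PRel_per01_subset_NSUBEXP_of_graph)
    (hU : NE_subset_SIZE_of_NEXP_subset_PPoly)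
    (hE : polyExists_NSUBEXP_subset_NSUBEXP) (hPIT : PITLanguage ∈ NSUBEXP)
    (hNEXP : NEXP ⊆ PPoly)
    (hper : IsPBounded (fun n => constantFreeComplexity (perPoly (Fin n) ℤ))) :
    ∃ k : ℕ, SigmaP 2 ⊆ ⋃ c : ℕ, SIZE (fun n => c * n ^ k + c) := by
  obtain ⟨k, hk⟩ := NTIME_two_pow_subset_SIZE_of_NEXP_subset_PPoly hU hNEXP
  exact ⟨k, ((SigmaP_two_subset_NSUBEXP_of_PIT hV h12 h3 hE hPIT hper).trans
    NSUBEXP_subset_NTIME_two_pow).trans hk⟩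

/-- **The three hypotheses are contradictory** (Aaronson–van Melkebeek 2011, §3.3: "All together
(3) yields a contradiction to the result of Kannan's that for every fixed constant `c` there
exists a language in `Σ₂ᵖ` that does not have Boolean circuits of size `n^c`"), Kannan's theorem
being the tree's proved `kannan_holds : ∀ k, ∃ L ∈ Σ₂ᵖ ∩ Π₂ᵖ, L ∉ ⋃_c SIZE(c·n^k + c)`.
[cite: AaronsonMelkebeek2011, §3.3] -/
theorem false_of_PIT_NEXP_per_avm (hV : permanent01_isSharpPHardFun)
    (h12 : permanent01Graph_mem_NSUBEXP_of_PIT) (h3 : PRel_per01_subset_NSUBEXP_of_graph)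
    (hU : NE_subset_SIZE_of_NEXP_subset_PPoly)
    (hE : polyExists_NSUBEXP_subset_NSUBEXP) (hPIT : PITLanguage ∈ NSUBEXP)
    (hNEXP : NEXP ⊆ PPoly)
    (hper : IsPBounded (fun n => constantFreeComplexity (perPoly (Fin n) ℤ))) : False := by
  obtain ⟨k, hk⟩ := SigmaP_two_subset_SIZE_of_facts hV h12 h3 hU hE hPIT hNEXP hper
  obtain ⟨L, hL, hLs⟩ := kannan_holds k
  exact hLs (hk hL.1)

/-! ### Assembly -/

/-- **pnp.S39 from five named facts, along Aaronson–van Melkebeek 2011.** If `PIT ∈ NSUBEXP`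
then `NEXP ⊄ P/poly` or `(PER_n)` has no p-bounded constant-free arithmetic circuits: otherwise
`Σ₂ᵖ ⊆ NSUBEXP ⊆ NTIME(2ⁿ) ⊆ NE ⊆ ⋃_c SIZE(c·n^k + c)` for one `k` (Lemma 3.1 and display (3)),
against Kannan's theorem.
Trust base: Valiant's `#P`-hardness of the `0/1` permanent, Kabanets–Impagliazzo's Cor. 12 and
Lemma 3, the fixed-exponent circuit-size consequence of `NEXP ⊆ P/poly` for `NE`, and the
`∃`-closure of `NSUBEXP` — no IKW, Meyer, Toda or time hierarchy (cf.
`kabanets_impagliazzo_of_facts`). When these are discharged this is `kabanets_impagliazzo_holds`.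
[cite: AaronsonMelkebeek2011, Thm. 2.1 (proof, §3.3)] [cite: KabanetsImpagliazzo2003, Thm. 18 (p. 359)] -/
theorem kabanets_impagliazzo_of_facts_avm (hV : permanent01_isSharpPHardFun)
    (h12 : permanent01Graph_mem_NSUBEXP_of_PIT) (h3 : PRel_per01_subset_NSUBEXP_of_graph)
    (hU : NE_subset_SIZE_of_NEXP_subset_PPoly)
    (hE : polyExists_NSUBEXP_subset_NSUBEXP) : kabanets_impagliazzo := by
  intro hPIT
  by_contra hcon
  rw [not_or, not_not, not_not] at hcon
  exact false_of_PIT_NEXP_per_avm hV h12 h3 hU hE (mem_NSUBEXP_iff.2 hPIT) hcon.1 hcon.2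

/-! ### Assembly from four facts (the `∃`-closure of `NSUBEXP` discharged) -/

/-- **pnp.S39 from FOUR named facts.** The same assembly with the `∃`-closure of `NSUBEXP`
discharged by `polyExists_NSUBEXP_subset_NSUBEXP_holds` (`Complexity/PolyExistsNTIME.lean`): the
trust base of `kabanets_impagliazzo` along Aaronson–van Melkebeek is now Valiant's `#P`-hardness
of the `0/1` permanent, Kabanets–Impagliazzo's Cor. 12 and Lemma 3, and the fixed-exponent
circuit-size consequence of `NEXP ⊆ P/poly` for `NE`.
[cite: AaronsonMelkebeek2011, Thm. 2.1 (proof, §3.3)] [cite: KabanetsImpagliazzo2003, Thm. 18 (p. 359)] -/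
theorem kabanets_impagliazzo_of_facts_avm' (hV : permanent01_isSharpPHardFun)
    (h12 : permanent01Graph_mem_NSUBEXP_of_PIT) (h3 : PRel_per01_subset_NSUBEXP_of_graph)
    (hU : NE_subset_SIZE_of_NEXP_subset_PPoly) : kabanets_impagliazzo :=
  kabanets_impagliazzo_of_facts_avm hV h12 h3 hU polyExists_NSUBEXP_subset_NSUBEXP_holds

/-! ### Assembly from three facts (the Aaronson–van Melkebeek fact discharged) -/

/-- **pnp.S39 from THREE named facts** — Valiant's `#P`-hardness of the `0/1` permanent,
Kabanets–Impagliazzo's Cor. 12 and Lemma 3: the fixed-exponent circuit-size consequence of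
`NEXP ⊆ P/poly` for `NE` is now a theorem (`NE_subset_SIZE_of_NEXP_subset_PPoly_holds`,
`Complexity/AaronsonVanMelkebeek2011Proofs.lean`). These three are exactly the results about the
permanent that the printed proof of Thm. 18 uses (its Thm. 1 = Valiant, Cor. 12, Lemma 3); the
Impagliazzo–Kabanets–Wigderson and Toda theorems of the printed line are avoided along
Aaronson–van Melkebeek. When the three are discharged, `kabanets_impagliazzo_holds` is this theorem
applied to their `_holds`.
[cite: AaronsonMelkebeek2011, Thm. 2.1 (proof, §3.3)] [cite: KabanetsImpagliazzo2003, Thm. 18 (p. 359), Thm. 1, Lemma 3, Cor. 12 (pp. 357–358)] -/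
theorem kabanets_impagliazzo_of_facts₃ (hV : permanent01_isSharpPHardFun)
    (h12 : permanent01Graph_mem_NSUBEXP_of_PIT) (h3 : PRel_per01_subset_NSUBEXP_of_graph) :
    kabanets_impagliazzo :=
  kabanets_impagliazzo_of_facts_avm' hV h12 h3 NE_subset_SIZE_of_NEXP_subset_PPoly_holds

/-- **pnp.S39 from Valiant's theorem, the reduction core of Cor. 12, and Lemma 3.** Cor. 12 is
assembled in `PermanentGraphNSUBEXP.lean` (`permanent01Graph_mem_NSUBEXP_of_PIT_of_facts`) from
its reduction statement `permanent01Graph_polyExists_preimage_PIT` (KI Lemma 11: one `FP` map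
sending the permanent graph, with a polynomially bounded guess, into `PITLanguage`), the closure
of `NSUBEXP` under Karp reductions (PROVED: `NSUBEXP_of_karpReducible_holds`) and its `∃`-closure
(PROVED: `polyExists_NSUBEXP_subset_NSUBEXP_holds`).
[cite: KabanetsImpagliazzo2003, Lemma 11 and proof of Cor. 12 (p. 358), Thm. 18 (p. 359)] [cite: AaronsonMelkebeek2011, Thm. 2.1 (proof, §3.3)] -/
theorem kabanets_impagliazzo_of_facts₃' (hV : permanent01_isSharpPHardFun)
    (hR : permanent01Graph_polyExists_preimage_PIT) (h3 : PRel_per01_subset_NSUBEXP_of_graph) :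
    kabanets_impagliazzo :=
  kabanets_impagliazzo_of_facts₃ hV
    (permanent01Graph_mem_NSUBEXP_of_PIT_of_facts hR NSUBEXP_of_karpReducible_holds
      polyExists_NSUBEXP_subset_NSUBEXP_holds) h3

end Literature.Computability.AlgebraicComplexity

end
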